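import Summits.CriticalPhenomena.CardyFormulaZ2.Theorems.CardyComplexConeParafermionToSLESixFamiliesDiamondFreeSideTurnCount
import Summits.CriticalPhenomena.CardyFormulaZ2.Theorems.CardyComplexConeParafermionToSLESixFamiliesDiamondDartPhaseRoutes
import Summits.CriticalPhenomena.CardyFormulaZ2.Theorems.CardyComplexConeParafermionToSLESixFamiliesDiamondDartPhaseTurns
import Summits.CriticalPhenomena.CardyFormulaZ2.Theorems.CardyComplexConeParafermionToSLESixFamiliesDiamondDartPhaseWired
import HarnessLib

/-!
# The turn count at the first boundary dart of every side: one value per mesh plus a quarter turn per diamond corner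
# (line `potential-darboux-picard-diamond`, S1p `stub_boundaryDartPhase`, part 6)

Crux `ParafermionToSLESixFamilies` (stmt-CriticalPhenomena-11389), line `potential-darboux-picard-diamond`, stub
`stub_boundaryDartPhase` (S1p). The lattice half of `BoundaryDartPhase`, for ONE admissible datum `E` on the marked diamond
(mesh `δ`, all lattice points of the diamond in `Ω_δ`): let `(x₀, k₀)` be the start corner, `p⋆` the outer corner of the face
across the start edge (off the diamond), `k⋆` a side of the frame beyond which `p⋆` lies, and `a` a frontier point within
`ε + 3δ` of `δ p⋆` (the mark at the start edge). For a boundary segment `[p, q]` on side `k` of the frame (`a ∉ (p, q)`) whose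
`6δ`-neighbourhood, `η/2`-trimmed, sees the discrete arcs of a FREE side (no `A`-site, boundary sites on `B`) resp. of a
WIRED side (no `B`-site, boundary sites on `A`), and a corner `(x, j)` with inner face within `3δ` of the segment, `η`-away
from `p, q`, with the free resp. wired dart pattern of `BoundaryDartPhase`, the turn count of the exploration at every passage
of `(x, j)` before the exit is

  `T = -2 - (k₀ - k⋆).val + s`,  `s = (k - k⋆).val` for `k ≠ k⋆`,  `s = 0 / 4` for `k = k⋆` according as `a` lies before
  `p` / after `q` along the side

(`turnCount_freeDart`, `turnCount_wiredDart` — the latter registered): the dart escapes through the bottom route (`k = k⋆`,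
`a` before; `k = k⋆ + 1`), the top route (`k = k⋆ + 2`) or the east route (`k = k⋆ + 3`; `k = k⋆`, `a` after) of
`route_cases`, by `turnCount_touchSite` (free) / `turnCount_wiredSite` (wired), and the values are those of
`turnValue_classes`.
-/

noncomputable section

namespace Summit.CriticalPhenomena.CardyFormulaZ2.Cruxes.ParafermionToSLESixFamilies.PotentialDarbouxPicardDiamond

open Set Metric Complex
open Literature.Probability Literature.Probability.LatticeModels Literature.Probability.Percolation
open Literature.Probability.LatticeModels.DiscreteDobrushin
open Literature.Probability.RandomPlanarGeometry

/-- The class index of a dart of side `k` relative to the side `k⋆` of `p⋆` and the position of the mark `a` along side `k⋆`. -/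
def dartClass (α β : ℝ) (k kp : Fin 4) (Ga sp : ℝ) : ℤ :=
  if k = kp then (if Ga ≤ sp - gam' α β kp then 0 else 4) else ((k - kp).val : ℕ)

section Common

variable {D : DobrushinDomain} {c : ℂ} {α β : ℝ}
  (hcar : D.carrier = {z | |((z - c) * exp (-(Real.pi / 4 : ℝ) * I)).re| < α ∧ |((z - c) * exp (-(Real.pi / 4 : ℝ) * I)).im| < β})
  {E : DiscreteDobrushin} (hE : E.IsZdAdmissible) {δ η ε : ℝ} (hδ : 0 < δ) (hδη : 100 * δ ≤ η) (hεη : 16 * ε ≤ η)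
  (hεm : 16 * ε ≤ min α β) (hδm : 10 * δ ≤ min α β) (hEΩ : E.Ω = D.carrier) (hEδ : E.δ = δ)
  (hgood : ∀ x : Site 2, meshPoint δ x ∈ D.carrier → x ∈ meshDomain D.carrier δ)
  {ps : Site 2} (hps : ps = (startCorner hE).1 + cornerUnit ((startCorner hE).2 + 3) ∨
    ps = (startCorner hE).1 + cornerUnit ((startCorner hE).2 + 3) + cornerUnit (startCorner hE).2)
  (hpsout : meshPoint δ ps ∉ D.carrier) {kp : Fin 4} (hkp : gam α β kp ≤ Fk kp (dRot c (meshPoint δ ps)))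
  {a : ℂ} (ha : a ∈ frontier D.carrier) (hpa : dist (meshPoint δ ps) a ≤ ε + 3 * δ)
  {k : Fin 4} {sp sq : ℝ} {p q : ℂ} (hsp0 : 0 ≤ sp) (hspq : sp < sq) (hsqL : sq ≤ dLen α β k)
  (hpk : dRot c p = dParam α β k sp) (hqk : dRot c q = dParam α β k sq) (haseg : a ∉ openSegment ℝ p q)

include hcar hδ hδη hεη hεm hδm hEΩ hEδ hgood hps hpsout hkp ha hpa hsp0 hspq hsqL hpk hqk haseg

omit hgood in
/-- **The route of a dart and its turn-count value.** For every side `k` there is a route `Q` of `route_cases` (in the frame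
of side `k`) such that `-4 - ((-1 + walkTurns (k + 1) Q) + g) = -2 - (k₀ - k⋆).val + dartClass`, together with its route
interface (outside classes, route data, safety on the `7δ`-window). -/
theorem exists_route_of_dart {gds : List (Fin 4)} {g : ℤ}
    (hgex : (gds = [(startCorner hE).2 + 1] ∧ g = 1) ∨ (gds = [(startCorner hE).2 + 1, (startCorner hE).2 + 2] ∧ g = 0))
    (hgds : gds ≠ []) (hgend : pathEnd ps gds = (startCorner hE).1)
    (hgV : ∀ v ∈ pathVerts ps gds, v = ps ∨ v = (startCorner hE).1 + cornerUnit (startCorner hE).2)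
    (hgnd : (pathVerts ps gds).Nodup) (hgx : (startCorner hE).1 ∉ pathVerts ps gds)
    (hgx1 : ∀ k : Fin 4, |xiC k (startCorner hE).1 - xiC k ps| ≤ 1 ∧ |upC k (startCorner hE).1 - upC k ps| ≤ 1)
    (hgV1 : ∀ k : Fin 4, ∀ v ∈ pathVerts ps gds, |xiC k v - xiC k ps| ≤ 1 ∧ |upC k v - upC k ps| ≤ 1)
    (ι : Site 2 → ℤ) (hι0 : ∀ v : Site 2, meshPoint δ v ∉ D.carrier → ι v = 0)
    (hι1 : ∀ v : Site 2, meshPoint δ v ∈ D.carrier → ι v = 1) :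
    ∃ (Q : List (Fin 4)) (C : Site 2 → Prop), -4 - ((-1 + walkTurns (k + 1) Q) + g) =
        -2 - (((startCorner hE).2 - kp).val : ℕ) + dartClass α β k kp (Gk kp (dRot c a)) sp ∧
      (∀ v : Site 2, C v → ι v = 0) ∧
      (∀ vs : Site 2, xiC k vs = 3 * ⌈(‖c‖ + α + β) / δ⌉₊ + 10 → upC k vs = -(3 * ⌈(‖c‖ + α + β) / δ⌉₊ + 10) →
        ∃ Qt : List (Fin 4), Q = (k + 2) :: Qt ∧ pathEnd vs Q = pathEnd ps gds ∧ lastDir Q = lastDir gds ∧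
          (∀ v ∈ pathVerts vs Q, C v ∨ v ∈ pathVerts ps gds) ∧ (pathVerts vs Q).Nodup ∧ pathEnd ps gds ∉ pathVerts vs Q ∧
          (∀ b ∈ pathVerts vs Q, b = vs ∨ xiC k b - upC k b ≤ 2 * (3 * ⌈(‖c‖ + α + β) / δ⌉₊ + 10) - 1)) ∧
      (∀ u : Site 2, gam α β k - 3 * δ ≤ Fk k (dRot c (meshPoint δ u)) → Fk k (dRot c (meshPoint δ u)) < gam α β k →
        sp + η - 7 * δ - gam' α β k ≤ Gk k (dRot c (meshPoint δ u)) → Gk k (dRot c (meshPoint δ u)) ≤ sq - η + 7 * δ - gam' α β k →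
        meshPoint δ u ∈ D.carrier → (∀ v : Site 2, C v → SafeVertex k u (3 * ⌈(‖c‖ + α + β) / δ⌉₊ + 10) ι v) ∧
          (∀ v ∈ pathVerts ps gds, SafeVertex k u (3 * ⌈(‖c‖ + α + β) / δ⌉₊ + 10) ι v)) := by
  have hcar' : D.carrier = {z | |(dRot c z).re| < α ∧ |(dRot c z).im| < β} := hcar
  set K₀ : ℕ := ⌈(‖c‖ + α + β) / δ⌉₊ with hK₀
  set x₀ := (startCorner hE).1 with hx₀
  set k₀ := (startCorner hE).2 with hk₀
  have hsc := isStartCorner_startCorner hE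
  have hx0in : meshPoint δ x₀ ∈ D.carrier := by
    have := mem_of_mem_zdBoundary (E.zdArcA_subset_zdBoundary hsc.mem_zdArcA); rwa [hEΩ, hEδ] at this
  have hεγ : 16 * ε ≤ gam α β k := hεm.trans (min_le_gam α β k)
  have hδγ : 10 * δ ≤ gam α β k := hδm.trans (min_le_gam α β k)
  have hK₀in : ∀ v : Site 2, meshPoint δ v ∈ D.carrier → |xiC k v| ≤ K₀ ∧ |upC k v| ≤ K₀ :=
    fun v hv => (abs_xiC_upC_le_iff k v K₀).2 (abs_coord_le_of_mem_carrier hcar' hδ hv)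
  have hK₀out : ∀ v : Site 2, (xiC k v = 3 * K₀ + 10 ∨ xiC k v = -(3 * K₀ + 10) ∨ upC k v = 3 * K₀ + 10 ∨
      upC k v = -(3 * K₀ + 10)) → meshPoint δ v ∉ D.carrier := by
    intro v hv h
    obtain ⟨h1, h2⟩ := hK₀in v h
    rw [abs_le] at h1 h2
    omega
  have hgV' : ∀ v ∈ pathVerts ps gds, v = ps ∨ (meshPoint δ v ∈ D.carrier ∧ |xiC k v - xiC k ps| ≤ 1 ∧ |upC k v - upC k ps| ≤ 1) := by
    intro v hv
    rcases hgV v hv with h | h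
    · exact Or.inl h
    · refine Or.inr ⟨?_, hgV1 k v hv⟩
      rw [h]
      have := mem_of_mem_zdBoundary (E.zdArcB_subset_zdBoundary hsc.mem_zdArcB); rwa [hEΩ, hEδ] at this
  have hRC := route_cases D c α β hcar k sp sq hsp0 hspq hsqL δ η ε hδ hδη hεη hεγ hδγ ι hι0 hι1 K₀ hK₀in hK₀out ps hpsout a ha
    hpa gds hgds hgV' hgnd (hgend ▸ hx0in) (hgend ▸ hgx) (hgend ▸ hgx1 k)
  -- coordinates of `p⋆`: run lengths of the routes are positive
  obtain ⟨hx0a, hx0b⟩ := hK₀in x₀ hx0in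
  obtain ⟨hd1, hd2⟩ := hgx1 k
  rw [abs_le] at hx0a hx0b hd1 hd2
  have r1 : 1 ≤ 3 * (K₀ : ℤ) + 10 - xiC k ps := by omega
  have r2 : 1 ≤ upC k ps + (3 * (K₀ : ℤ) + 10) := by omega
  have r3 : 1 ≤ 2 * (3 * (K₀ : ℤ) + 10) := by omega
  have r4 : 1 ≤ xiC k ps + (3 * (K₀ : ℤ) + 10) := by omega
  have r5 : 1 ≤ 3 * (K₀ : ℤ) + 10 - upC k ps := by omega
  -- the start corner does not point away from side `k⋆`
  have hne : k₀ - kp ≠ 3 := by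
    refine startIndex_ne (c := c) (α := α) (β := β) hδ hps ?_ hkp
    exact (abs_lt.1 ((mem_carrier_iff_frame hcar' kp _).1 hx0in).1).2
  obtain ⟨c0, c1, c2, c3, c4⟩ := turnValue_classes k₀ kp hne
  -- the frames of the four sides in terms of the frame of `k⋆`
  obtain ⟨hF1, hG1⟩ := Fk_succ kp (dRot c (meshPoint δ ps))
  obtain ⟨hF2, hG2⟩ := Fk_add_two kp (dRot c (meshPoint δ ps))
  obtain ⟨hF3, hG3⟩ := Fk_add_three kp (dRot c (meshPoint δ ps))
  obtain ⟨hg1, hg1', hg2, hg2', hg3, hg3'⟩ := gam_succ α β kp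
  -- the class of the dart
  obtain ⟨r, hr⟩ := exists_eq_add kp k
  have hk4 : k = kp ∨ k = kp + 1 ∨ k = kp + 2 ∨ k = kp + 3 := by
    fin_cases r
    · exact Or.inl (by simpa using hr)
    · exact Or.inr (Or.inl (by simpa using hr))
    · exact Or.inr (Or.inr (Or.inl (by simpa using hr)))
    · exact Or.inr (Or.inr (Or.inr (by simpa using hr)))
  have hne1 : ∀ kp : Fin 4, kp + 1 ≠ kp ∧ kp + 2 ≠ kp ∧ kp + 3 ≠ kp := by decide
  rcases hk4 with hk | rfl | rfl | rfl
  · -- side `k⋆` itself: bottom or east by the position of the mark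
    obtain rfl : kp = k := hk.symm
    by_cases hGa : Gk kp (dRot c a) ≤ sp - gam' α β kp
    · obtain ⟨C, hC0, hQdata, hQsafe⟩ := hRC _ (Or.inr (Or.inr ⟨rfl, Or.inr ⟨hkp, hGa⟩⟩))
      refine ⟨_, C, ?_, hC0, hQdata, hQsafe⟩
      rw [turnValue_bot hgex r1 r2, dartClass, if_pos rfl, if_pos hGa, c0]; ring
    · have hopp : -gam α β kp < Fk kp (dRot c a) := by
        have hρ : ‖dRot c (meshPoint δ ps) - dRot c a‖ ≤ ε + 3 * δ := by rw [← dist_eq_norm, dist_dRot]; exact hpa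
        have hρF := (abs_le.1 ((abs_Fk_sub_le kp _ _).trans hρ))
        have hεγ' : 16 * ε ≤ gam α β kp := hεm.trans (min_le_gam α β kp)
        have hδγ' : 10 * δ ≤ gam α β kp := hδm.trans (min_le_gam α β kp)
        linarith
      obtain ⟨-, -, hbd⟩ := frame_of_mem_frontier hcar' kp ha
      rw [dLen_eq] at hsqL
      have hafter : sq - gam' α β kp ≤ Gk kp (dRot c a) :=
        (tangential_dichotomy_of_not_mem_openSegment hpk hqk hsp0 hsqL hbd hopp haseg).resolve_left hGa
      obtain ⟨C, hC0, hQdata, hQsafe⟩ := hRC _ (Or.inl ⟨rfl, Or.inr ⟨hkp, hafter⟩⟩)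
      refine ⟨_, C, ?_, hC0, hQdata, hQsafe⟩
      rw [turnValue_east hgex r3 r5 r1, dartClass, if_pos rfl, if_neg hGa, c4]
  · -- side `k⋆ + 1`: bottom
    obtain ⟨C, hC0, hQdata, hQsafe⟩ := hRC _ (Or.inr (Or.inr ⟨rfl, Or.inl (by rw [hG1, hg1']; linarith)⟩))
    refine ⟨_, C, ?_, hC0, hQdata, hQsafe⟩
    rw [turnValue_bot hgex r1 r2, dartClass, if_neg (hne1 kp).1, c1]
    have : ∀ kp : Fin 4, ((kp + 1 - kp).val : ℕ) = 1 := by decide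
    rw [this]; ring
  · -- side `k⋆ + 2`: top
    obtain ⟨C, hC0, hQdata, hQsafe⟩ := hRC _ (Or.inr (Or.inl ⟨rfl, by rw [hF2, hg2]; linarith⟩))
    refine ⟨_, C, ?_, hC0, hQdata, hQsafe⟩
    rw [turnValue_top hgex r3 r4 r5, dartClass, if_neg (hne1 kp).2.1, c2]
    have : ∀ kp : Fin 4, ((kp + 2 - kp).val : ℕ) = 2 := by decide
    rw [this]; ring
  · -- side `k⋆ + 3`: east
    obtain ⟨C, hC0, hQdata, hQsafe⟩ := hRC _ (Or.inl ⟨rfl, Or.inl (by rw [hG3, hg3']; exact hkp)⟩)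
    refine ⟨_, C, ?_, hC0, hQdata, hQsafe⟩
    rw [turnValue_east hgex r3 r5 r1, dartClass, if_neg (hne1 kp).2.2, c3]
    have : ∀ kp : Fin 4, ((kp + 3 - kp).val : ℕ) = 3 := by decide
    rw [this]; ring

/-- **The turn count at a free touch dart.** See the module docstring. -/
theorem turnCount_freeDart
    (harcs : ∀ x : Site 2, infDist (meshPoint δ x) (segment ℝ p q) ≤ 6 * δ → η / 2 ≤ dist (meshPoint δ x) p →
      η / 2 ≤ dist (meshPoint δ x) q → x ∉ E.zdArcA ∧ (x ∈ E.zdBoundary → x ∈ E.zdArcB))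
    {x : Site 2} {j : Fin 4} (hd : infDist (meshPoint δ x) (segment ℝ p q) ≤ 3 * δ) (hp : η ≤ dist (meshPoint δ x) p)
    (hq : η ≤ dist (meshPoint δ x) q) (hface : E.IsInnerFace (faceAt x j)) (hxB : x ∉ E.zdArcB)
    (hb1 : x + cornerUnit (j + 1) ∈ E.zdArcB) (hb2 : x + cornerUnit (j + 2) ∈ E.zdArcB)
    (ω : BondConfig (Site 2)) {t : ℕ} (ht : t < exitTime hE ω) (horb : cornerOrbit (E.bcBondConfig ω) (startCorner hE) t = (x, j)) :
    j = k + 2 ∧ turnCount (E.bcBondConfig ω) (startCorner hE) t =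
      -2 - (((startCorner hE).2 - kp).val : ℕ) + dartClass α β k kp (Gk kp (dRot c a)) sp := by
  classical
  have hcar' : D.carrier = {z | |(dRot c z).re| < α ∧ |(dRot c z).im| < β} := hcar
  have hδγ : 10 * δ ≤ gam α β k := hδm.trans (min_le_gam α β k)
  have hxin : meshPoint δ x ∈ D.carrier := by
    have := corner_mem_of_isInnerFace hface (isCorner_faceAt x j)
    rwa [hEΩ, hEδ] at this
  have hj : j = k + 2 := freeSite_pin hcar' hsp0 hsqL hpk hqk hspq.le hδ hδη hδγ hEΩ hEδ hgood hd hp hq hxin harcs hface hxB hb1 hb2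
  subst hj
  refine ⟨rfl, ?_⟩
  set K₀ : ℕ := ⌈(‖c‖ + α + β) / δ⌉₊ with hK₀
  have hK₀in : ∀ v : Site 2, meshPoint δ v ∈ D.carrier → |xiC k v| ≤ K₀ ∧ |upC k v| ≤ K₀ :=
    fun v hv => (abs_xiC_upC_le_iff k v K₀).2 (abs_coord_le_of_mem_carrier hcar' hδ hv)
  have hK₀out : ∀ v : Site 2, (xiC k v = 3 * K₀ + 10 ∨ xiC k v = -(3 * K₀ + 10) ∨ upC k v = 3 * K₀ + 10 ∨
      upC k v = -(3 * K₀ + 10)) → meshPoint δ v ∉ D.carrier := by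
    intro v hv h
    obtain ⟨h1, h2⟩ := hK₀in v h
    rw [abs_le] at h1 h2
    omega
  set ι : Site 2 → ℤ := fun v => if meshPoint δ v ∈ D.carrier then 1 else 0 with hι
  have hι0 : ∀ v : Site 2, meshPoint δ v ∉ D.carrier → ι v = 0 := fun v h => by simp [hι, h]
  have hι1 : ∀ v : Site 2, meshPoint δ v ∈ D.carrier → ι v = 1 := fun v h => by simp [hι, h]
  obtain ⟨gds, g, hgex, hgds, hgend, hgV, hgnd, hgx, hgx1, hgV1, hHT⟩ := gadget_dataC E hE ps hps
  obtain ⟨Q, C, hval, hC0, hQdata, hQsafe⟩ := exists_route_of_dart hcar hE hδ hδη hεη hεm hδm hEΩ hEδ hps hpsout hkp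
    ha hpa hsp0 hspq hsqL hpk hqk haseg hgex hgds hgend hgV hgnd hgx hgx1 hgV1 ι hι0 hι1
  rw [← hval]
  have hHTv : ∀ (u : Site 2) (j : Fin 4) (ds : List (Fin 4)) (d : Site 2 × Fin 4) (S : ℤ), ds.head? = some (j + 1) →
      2 ≤ ds.length → pathEnd u ds = (startCorner hE).1 → lastDir ds = lastDir gds →
      (∀ v ∈ (pathVerts u ds).tail, (∀ i : Fin 4, ¬ E.IsInnerFace (faceAt v i)) ∨ v ∈ E.zdArcB) →
      (pathVerts u ds ++ [(startCorner hE).1]).Nodup → d ∈ cornerWalk u j ds → d.2 = j + 3 →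
      (∀ p' : Site 2 × Fin 4, E.IsInnerFace (cFace p') → sideVal j (cpos p') ≤ S) →
      (∀ d' ∈ cornerWalk u j ds, sideVal j (cpos d') ≤ S) → sideVal j (cpos ((startCorner hE).1, (startCorner hE).2 + 3)) ≤ S →
      sideVal j (cpos d) = S → ∀ (ω : BondConfig (Site 2)) (t : ℕ), t < exitTime hE ω →
      cornerOrbit (E.bcBondConfig ω) (startCorner hE) t = (u, j) → turnCount (E.bcBondConfig ω) (startCorner hE) t = -4 - (walkTurns j ds + g) :=
    fun u j ds d S hhead hlen hend hlast hforb hnodup hdm hidx hI hEc hx hdS ω t ht horb =>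
      hHT u j ds d S hlen hend hlast (cornerForbidden_of_vertexForbidden hhead hforb) hnodup hdm hidx hI hEc hx hdS ω t ht horb
  exact turnCount_touchSite D c α β hcar k sp sq p q hsp0 hsqL hpk hqk hspq.le E hE δ η hδ hδη hδγ hEΩ hEδ hgood harcs ι hι0 hι1 K₀
    hK₀in hK₀out ps hpsout gds g hgds hgend hgV hHTv Q C hC0 hQdata
    (fun u h1 h2 h3 h4 h5 => hQsafe u h1 h2 (by linarith) (by linarith) h5) x hd hp hq hb1 ω t ht horb

end Common

/-- **The turn count at the first dart of the wired arc** (registered helper of `stub_boundaryDartPhase`). See the module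
docstring. -/
theorem turnCount_wiredDart : ∀ (D : DobrushinDomain) (c : ℂ) (α β : ℝ), D.carrier = {z | |((z - c) * exp (-(Real.pi / 4 : ℝ) * I)).re| < α ∧ |((z - c) * exp (-(Real.pi / 4 : ℝ) * I)).im| < β} → ∀ (E : DiscreteDobrushin) (hE : E.IsZdAdmissible) (δ η ε : ℝ), 0 < δ → 100 * δ ≤ η → 16 * ε ≤ η → 16 * ε ≤ min α β → 10 * δ ≤ min α β → E.Ω = D.carrier → E.δ = δ → (∀ x : Site 2, meshPoint δ x ∈ D.carrier → x ∈ meshDomain D.carrier δ) → ∀ (ps : Site 2), (ps = (startCorner hE).1 + cornerUnit ((startCorner hE).2 + 3) ∨ ps = (startCorner hE).1 + cornerUnit ((startCorner hE).2 + 3) + cornerUnit (startCorner hE).2) → meshPoint δ ps ∉ D.carrier → ∀ (kp : Fin 4), gam α β kp ≤ Fk kp (dRot c (meshPoint δ ps)) → ∀ (a : ℂ), a ∈ frontier D.carrier → dist (meshPoint δ ps) a ≤ ε + 3 * δ → ∀ (k : Fin 4) (sp sq : ℝ) (p q : ℂ), 0 ≤ sp → sp < sq → sq ≤ dLen α β k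 → dRot c p = dParam α β k sp → dRot c q = dParam α β k sq → a ∉ openSegment ℝ p q → (∀ x : Site 2, infDist (meshPoint δ x) (segment ℝ p q) ≤ 6 * δ → η / 2 ≤ dist (meshPoint δ x) p → η / 2 ≤ dist (meshPoint δ x) q → x ∉ E.zdArcB ∧ (x ∈ E.zdBoundary → x ∈ E.zdArcA)) → ∀ (x : Site 2) (j : Fin 4), infDist (meshPoint δ x) (segment ℝ p q) ≤ 3 * δ → η ≤ dist (meshPoint δ x) p → η ≤ dist (meshPoint δ x) q → E.IsInnerFace (faceAt x j) → x ∈ E.zdArcA → x + cornerUnit (j + 1) ∈ E.zdArcA → x + cornerUnit (j + 2) ∈ E.zdArcA → ∀ (ω : BondConfig (Site 2)) (t : ℕ), t < exitTime hE ω → cornerOrbit (E.bcBondConfig ω) (startCorner hE) t = (x, j) → j = k + 2 ∧ turnCount (E.bcBondConfig ω) (startCorner hE) t = -2 - (((startCorner hE).2 - kp).val : ℕ) + dartClass α β k kp (Gk kp (dRot c a)) sp := by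
  intro D c α β hcar E hE δ η ε hδ hδη hεη hεm hδm hEΩ hEδ hgood ps hps hpsout kp hkp a ha hpa k sp sq p q hsp0 hspq hsqL hpk hqk
    haseg harcs x j hd hp hq hface hxA hA1 hA2 ω t ht horb
  classical
  have hcar' : D.carrier = {z | |(dRot c z).re| < α ∧ |(dRot c z).im| < β} := hcar
  have hδγ : 10 * δ ≤ gam α β k := hδm.trans (min_le_gam α β k)
  obtain ⟨hj, hxin, huin, ⟨hFu1, hFu2, hGu1, hGu2⟩, houtX, hnoB⟩ := wiredSite_local D c α β hcar k sp sq p q hsp0 hsqL hpk hqk hspq.le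
    E δ η hδ hδη hδγ hEΩ hEδ hgood harcs x j hd hp hq hface hxA hA1 hA2
  subst hj
  refine ⟨rfl, ?_⟩
  set K₀ : ℕ := ⌈(‖c‖ + α + β) / δ⌉₊ with hK₀
  have hK₀in : ∀ v : Site 2, meshPoint δ v ∈ D.carrier → |xiC k v| ≤ K₀ ∧ |upC k v| ≤ K₀ :=
    fun v hv => (abs_xiC_upC_le_iff k v K₀).2 (abs_coord_le_of_mem_carrier hcar' hδ hv)
  have hK₀out : ∀ v : Site 2, (xiC k v = 3 * K₀ + 10 ∨ xiC k v = -(3 * K₀ + 10) ∨ upC k v = 3 * K₀ + 10 ∨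
      upC k v = -(3 * K₀ + 10)) → meshPoint δ v ∉ D.carrier := by
    intro v hv h
    obtain ⟨h1, h2⟩ := hK₀in v h
    rw [abs_le] at h1 h2
    omega
  set ι : Site 2 → ℤ := fun v => if meshPoint δ v ∈ D.carrier then 1 else 0 with hι
  have hι0 : ∀ v : Site 2, meshPoint δ v ∉ D.carrier → ι v = 0 := fun v h => by simp [hι, h]
  have hι1 : ∀ v : Site 2, meshPoint δ v ∈ D.carrier → ι v = 1 := fun v h => by simp [hι, h]
  obtain ⟨gds, g, hgex, hgds, hgend, hgV, hgnd, hgx, hgx1, hgV1, hHT⟩ := gadget_dataC E hE ps hps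
  obtain ⟨Q, C, hval, hC0, hQdata, hQsafe⟩ := exists_route_of_dart hcar hE hδ hδη hεη hεm hδm hEΩ hEδ hps hpsout hkp
    ha hpa hsp0 hspq hsqL hpk hqk haseg hgex hgds hgend hgV hgnd hgx hgx1 hgV1 ι hι0 hι1
  rw [← hval]
  exact turnCount_wiredSite D c α β hcar k E hE δ hδ hEΩ hEδ ι hι0 hι1 K₀ hK₀in hK₀out ps hpsout gds g hgds hgend hgV hHT Q C hC0
    hQdata x hxin huin houtX hnoB (hQsafe _ hFu1 hFu2 hGu1 hGu2 huin) ω t ht horb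

end Summit.CriticalPhenomena.CardyFormulaZ2.Cruxes.ParafermionToSLESixFamilies.PotentialDarbouxPicardDiamond

end
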